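import Mathlib
import HarnessLib
import Summits.Ventures.LatticeQCDFlow.Exactness.OpenBoundaryHMCForce
import Summits.Ventures.LatticeQCDFlow.Scoring.WeightedStapleSum

/-!
# Dictionary: the weighted loop sum of the open-boundary HMC force is the link times the weighted staple sum, `Ω^w_e(V) = V_e · R^w_e(V)`

HONEST FRAMING: exact (Metropolis-corrected) sampling algorithms for lattice gauge theory;
figures of merit are autocorrelation/cost numbers at stated couplings and volumes; no
continuum-physics claim.

Venture `LatticeQCDFlow` (cell pub-lqcd), topic `Exactness`, FANOUT row 21 (`su3-base`, arm `OBC-HMC`).  NEW WORK of the cell,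
def-free, joining row 21's `OpenBoundaryHMCForce` (`plaqWeight`, `weightedLoopSum`, `sunWeightedForce`,
`sunCoordι_sunWeightedForce`) and `Scoring/WeightedStapleSum` (`weightedStapleSum`, the exact local difference of the
weighted action; `plaqOf` of row 16's `WilsonStapleSum`); the unit-weight statement is row 16's
`plaquetteLoopSum_eq_mul_stapleSum`.  Nothing is cited as a fact; no number.

* `plaqWeight_eq_plaqOf_true` / `_false` — the two weight readers agree: `plaqWeight w x μ ν = w (plaqOf x μ (ν, upper))`,
  `plaqWeight w (x − ν̂) μ ν = w (plaqOf x μ (ν, lower))`;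
* **`weightedLoopSum_eq_mul_weightedStapleSum`** — `Ω^w_{x,μ}(V) = V(x,μ) · R^w_{x,μ}(V)` (fundamental representation);
* **`sunCoordι_sunWeightedForce_eq_staple`** — the increment the `OBC-HMC` kernel of `OpenBoundaryHMCForce` runs is, as a
  matrix, `(β/2)·P(V_e R^w_e(V))` — the weighted-STAPLE force, i.e. (with `β = β_eng/N`) the exact gradient
  `(β_eng/2N)·TA(V_e R^w_e)` of `WeightedForceGradient` / the local action difference of `WeightedStapleSum`.

NOT CLAIMED: anything new about convergence or exactness (those are the cited files'); numbers.
-/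

noncomputable section

namespace Summit.Ventures.LatticeQCDFlow.Exactness

open Literature.MathematicalPhysics.QuantumFieldTheory
open Literature.MathematicalPhysics.QuantumLattice (fundamentalRep fundamentalRep_apply)
open Summit.Ventures.LatticeQCDFlow.Scoring (weightedStapleSum plaqOf stapleUp stapleDown plaquetteHolonomy_eq_mul_stapleUp
  conj_plaquetteHolonomy_eq_mul_stapleDown)

variable {d L N : ℕ} (w : Plaquette d L → ℝ)

/-- The upper weight: `plaqWeight w x μ ν = w (plaqOf x μ (ν, true))` (`ν ≠ μ`). -/
theorem plaqWeight_eq_plaqOf_true (x : Site d L) {μ : Fin d} (ν : {ν : Fin d // ν ≠ μ}) :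
    plaqWeight w x μ ν = w (plaqOf x μ (ν, true)) := by
  unfold plaqWeight plaqOf
  rw [dif_neg (Ne.symm ν.2)]
  rfl

/-- The lower weight: `plaqWeight w (x − ν̂) μ ν = w (plaqOf x μ (ν, false))` (`ν ≠ μ`). -/
theorem plaqWeight_eq_plaqOf_false (x : Site d L) {μ : Fin d} (ν : {ν : Fin d // ν ≠ μ}) :
    plaqWeight w (x - Pi.single (ν : Fin d) 1) μ ν = w (plaqOf x μ (ν, false)) := by
  unfold plaqWeight plaqOf
  rw [dif_neg (Ne.symm ν.2)]
  rfl

/-- **`Ω^w_{x,μ}(V) = V(x,μ) · R^w_{x,μ}(V)`**: the weighted loop sum of `OpenBoundaryHMCForce` is the link matrix times the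
weighted staple sum of `WeightedStapleSum` (fundamental representation; every weight, every `d`, `L`). -/
theorem weightedLoopSum_eq_mul_weightedStapleSum (V : GaugeConfig d L (Matrix.specialUnitaryGroup (Fin N) ℂ))
    (x : Site d L) (μ : Fin d) :
    weightedLoopSum w V x μ =
      ((V (x, μ) : Matrix.specialUnitaryGroup (Fin N) ℂ) : Matrix (Fin N) (Fin N) ℂ) *
        weightedStapleSum w (fundamentalRep (Fin N)) V x μ := by
  classical
  have hmem : ∀ ν : Fin d, ν ∈ Finset.univ.erase μ ↔ ν ≠ μ := fun ν => by
    rw [Finset.mem_erase, and_iff_left (Finset.mem_univ ν)]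
  -- the subtype sum of the weighted staple sum as a sum over `univ.erase μ`
  set f : Fin d → Matrix (Fin N) (Fin N) ℂ := fun ν =>
    if h : ν ≠ μ then
      ((V (x, μ) : Matrix.specialUnitaryGroup (Fin N) ℂ) : Matrix (Fin N) (Fin N) ℂ) *
        (w (plaqOf x μ (⟨ν, h⟩, true)) • fundamentalRep (Fin N) (stapleUp V x μ ν) +
          w (plaqOf x μ (⟨ν, h⟩, false)) • fundamentalRep (Fin N) (stapleDown V x μ ν))
    else 0 with hf
  have hR : ((V (x, μ) : Matrix.specialUnitaryGroup (Fin N) ℂ) : Matrix (Fin N) (Fin N) ℂ) *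
        weightedStapleSum w (fundamentalRep (Fin N)) V x μ = ∑ ν ∈ Finset.univ.erase μ, f ν := by
    rw [weightedStapleSum, Finset.mul_sum, Finset.sum_subtype (Finset.univ.erase μ) hmem f]
    refine Finset.sum_congr rfl fun i _ => ?_
    rw [hf]
    simp only [dif_pos i.2]
  rw [hR, weightedLoopSum, ← Finset.sum_erase_add _ _ (Finset.mem_univ μ), if_pos rfl, add_zero]
  refine Finset.sum_congr rfl fun ν hν => ?_
  have hne : ν ≠ μ := Finset.ne_of_mem_erase hν
  rw [if_neg hne, hf]
  simp only [dif_pos hne]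
  rw [Matrix.mul_add, Matrix.mul_smul, Matrix.mul_smul, fundamentalRep_apply, fundamentalRep_apply,
    plaquetteHolonomy_eq_mul_stapleUp, conj_plaquetteHolonomy_eq_mul_stapleDown, WilsonFlow.coe_mul_SU,
    WilsonFlow.coe_mul_SU, plaqWeight_eq_plaqOf_true w x ⟨ν, hne⟩, plaqWeight_eq_plaqOf_false w x ⟨ν, hne⟩]

/-- **THE `OBC-HMC` INCREMENT IS THE WEIGHTED-STAPLE FORCE**: as a matrix, `ι(sunWeightedForce N w β V e) =
(β/2)·P(V_e · R^w_e(V))`. -/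
theorem sunCoordι_sunWeightedForce_eq_staple (β : ℝ) (V : GaugeConfig d L (Matrix.specialUnitaryGroup (Fin N) ℂ))
    (e : Edge d L) :
    sunCoordι N (sunWeightedForce N w β V e) =
      (β / 2) • suProj (((V e : Matrix.specialUnitaryGroup (Fin N) ℂ) : Matrix (Fin N) (Fin N) ℂ) *
        weightedStapleSum w (fundamentalRep (Fin N)) V e.1 e.2) := by
  rw [sunCoordι_sunWeightedForce, weightedLoopSum_eq_mul_weightedStapleSum]

end Summit.Ventures.LatticeQCDFlow.Exactness
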